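import Literature.Barriers.CriticalPhenomena.LaceExpansionPcInputs
import Mathlib.MeasureTheory.Constructions.HaarToSphere
import HarnessLib

/-!
# The Fourier transform of Hara's kernel `J`: realness and the integrability of `(1 - Ĵ)⁻¹`

Barrier catalogue `Literature/Barriers/CriticalPhenomena/` (D-0021), companion of
`LaceExpansionXSpaceAsymptotics.lean` (objects `latticeFT`, `cube`, `kdot`, `IsZdSymmetric`,
`HaraKernelHyp`) over the lattice Fourier toolkit of `LaceExpansionPcInputs.lean`
(`continuous_latticeFT`, `norm_latticeFT_le`, `measurableSet_cube`). First analytic inputs of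
Hara's Gaussian lemma (Hara 2008, Thm. 1.3, §2), all PROVED:

* `IsZdSymmetric.neg` — `ℤ^d`-symmetric functions are even;
* `latticeFT_eq_re_of_even`, `one_sub_latticeFT_eq_ofReal` — for an even absolutely summable
  kernel `Ĵ(k) = Σ_x J(x)cos(k·x)` is real (first display of the proof of Lemma 2.1);
* `integrableOn_inv_one_sub_latticeFT` — **the well-definedness of `C(x)`** ("the integrability
  of `{1 - Ĵ(k)}⁻¹` by (1.18)", §2.1): for `d ≥ 3` and the infrared bound
  `1 - Re Ĵ(k) ≥ K₀|k|²/(2d)` on `[-π,π]^d`, `|1/(1 - Ĵ(k))| ≤ (2d/K₀)‖k‖_∞^{-2}`, which is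
  integrable on the cube by polar coordinates (`integrableOn_fun_norm_addHaar`: `r^{d-1}r^{-2}` is
  bounded on `(0, π+1)`).

## References

* T. Hara, Ann. Probab. 36 (2008) 530–593 (arXiv:math-ph/0504021): Thm. 1.3 (hypothesis (1.18)),
  §2.1 (integral representation (2.1)–(2.2) and the integrability remark), Lemma 2.1 and its proof.
-/

noncomputable section

namespace Literature.Barriers.CriticalPhenomena

open MeasureTheory Filter Finset Literature.Probability.LatticeModels Literature.Probability.Percolation
open scoped Topology BigOperators

variable {d : ℕ}

/-! ### `Ĵ` is real for an even kernel -/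

/-- `ℤ^d`-symmetric functions are even. [folklore] -/
theorem IsZdSymmetric.neg {g : Site d → ℝ} (hg : IsZdSymmetric g) (y : Site d) : g (-y) = g y := by
  have h := hg (Equiv.refl _) (fun _ => -1) y
  have he : Site.signedPerm (Equiv.refl _) (fun _ => (-1 : ℤˣ)) y = -y := by
    funext i; simp [Site.signedPerm_apply]
  rwa [he] at h

/-- For an even absolutely summable kernel, `Ĵ(k)` is real: `Ĵ(k) = Σ_x J(x) cos(k·x)`.
[cite: Hara2008, proof of Lemma 2.1 (first display)] -/
theorem latticeFT_eq_re_of_even {J : Site d → ℝ} (hJ : Summable fun x => |J x|)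
    (hJe : ∀ x, J (-x) = J x) (k : Fin d → ℝ) :
    latticeFT J k = ((∑' x, J x * Real.cos (kdot k x) : ℝ) : ℂ) := by
  -- symmetrise the defining series under `x ↦ -x`
  have hs := summable_latticeFT_term hJ k
  have hneg : latticeFT J k = ∑' x, (J x : ℂ) * Complex.exp (Complex.I * (kdot k x : ℂ)) := by
    unfold latticeFT
    rw [← (Equiv.neg (Site d)).tsum_eq]
    refine tsum_congr fun x => ?_
    simp only [Equiv.neg_apply, hJe]
    congr 1
    have : kdot k (-x) = -kdot k x := by simp [kdot, Finset.sum_neg_distrib]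
    rw [this]; push_cast; ring_nf
  have h2 : 2 * latticeFT J k = ∑' x, (J x : ℂ) * (2 * Real.cos (kdot k x)) := by
    have hs' : Summable fun x => (J x : ℂ) * Complex.exp (Complex.I * (kdot k x : ℂ)) := by
      refine Summable.of_norm ?_
      refine hJ.congr fun x => ?_
      rw [norm_mul, Complex.norm_real, Complex.norm_exp, Real.norm_eq_abs]; simp
    calc 2 * latticeFT J k = latticeFT J k + latticeFT J k := two_mul _
      _ = (∑' x, (J x : ℂ) * Complex.exp (-(Complex.I * (kdot k x : ℂ)))) +
            ∑' x, (J x : ℂ) * Complex.exp (Complex.I * (kdot k x : ℂ)) := by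
          nth_rewrite 2 [hneg]; rfl
      _ = ∑' x, ((J x : ℂ) * Complex.exp (-(Complex.I * (kdot k x : ℂ))) +
            (J x : ℂ) * Complex.exp (Complex.I * (kdot k x : ℂ))) := (Summable.tsum_add hs hs').symm
      _ = ∑' x, (J x : ℂ) * (2 * Real.cos (kdot k x)) := by
          refine tsum_congr fun x => ?_
          rw [← mul_add, Complex.ofReal_cos, Complex.two_cos, neg_mul, add_comm]
          ring_nf
  have h3 : ∑' x, (J x : ℂ) * (2 * Real.cos (kdot k x)) = 2 * ((∑' x, J x * Real.cos (kdot k x) : ℝ) : ℂ) := by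
    rw [Complex.ofReal_tsum, ← tsum_mul_left]
    refine tsum_congr fun x => ?_
    push_cast; ring
  have := h2.trans h3
  exact mul_left_cancel₀ (two_ne_zero) this

/-- Hence `(Ĵ(k)).re = Ĵ(k)` and `1 - Ĵ(k)` is the real number `1 - Re Ĵ(k)`. [folklore] -/
theorem one_sub_latticeFT_eq_ofReal {J : Site d → ℝ} (hJ : Summable fun x => |J x|)
    (hJe : ∀ x, J (-x) = J x) (k : Fin d → ℝ) :
    1 - latticeFT J k = ((1 - (latticeFT J k).re : ℝ) : ℂ) := by
  rw [latticeFT_eq_re_of_even hJ hJe k, Complex.ofReal_re, Complex.ofReal_sub, Complex.ofReal_one]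

/-! ### Integrability of `(1 - Ĵ)⁻¹` on `[-π,π]^d` for `d ≥ 3` -/

/-- `‖k‖_∞² ≤ |k|² = Σ_i k_i²`. [folklore] -/
theorem norm_sq_le_sum_sq (k : Fin d → ℝ) : ‖k‖ ^ 2 ≤ ∑ i, k i ^ 2 := by
  have h : ‖k‖ ≤ Real.sqrt (∑ i, k i ^ 2) := by
    refine (pi_norm_le_iff_of_nonneg (Real.sqrt_nonneg _)).2 fun i => ?_
    rw [Real.norm_eq_abs, ← Real.sqrt_sq_eq_abs]
    exact Real.sqrt_le_sqrt (Finset.single_le_sum (fun j _ => sq_nonneg (k j)) (Finset.mem_univ i))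
  calc ‖k‖ ^ 2 ≤ Real.sqrt (∑ i, k i ^ 2) ^ 2 := pow_le_pow_left₀ (norm_nonneg _) h 2
    _ = ∑ i, k i ^ 2 := Real.sq_sqrt (Finset.sum_nonneg fun i _ => sq_nonneg _)

/-- The cube `[-π,π]^d` lies in the sup-norm ball of radius `π + 1`. [folklore] -/
theorem cube_subset_ball (d : ℕ) : cube d ⊆ Metric.ball (0 : Fin d → ℝ) (Real.pi + 1) := by
  intro k hk
  rw [Metric.mem_ball, dist_zero_right]
  have h : ‖k‖ ≤ Real.pi := by
    refine (pi_norm_le_iff_of_nonneg Real.pi_pos.le).2 fun i => ?_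
    rw [Real.norm_eq_abs, abs_le]
    exact hk i (Set.mem_univ i)
  linarith

/-- `k ↦ ‖k‖_∞^{-2}` is integrable on sup-norm balls of `ℝ^d` for `d ≥ 3` (polar coordinates:
`r^{d-1} r^{-2} = r^{d-3}` is bounded on `(0, R)`). [folklore] -/
theorem integrableOn_norm_rpow_neg_two_ball (hd : 3 ≤ d) (R : ℝ) :
    IntegrableOn (fun k : Fin d → ℝ => ‖k‖ ^ (-2 : ℝ)) (Metric.ball 0 R) := by
  haveI : Nontrivial (Fin d → ℝ) := by
    haveI : Nonempty (Fin d) := ⟨⟨0, by omega⟩⟩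
    infer_instance
  rw [integrableOn_fun_norm_addHaar (volume : Measure (Fin d → ℝ)) (f := fun y : ℝ => y ^ (-2 : ℝ)) (r := R)]
  have hdim : Module.finrank ℝ (Fin d → ℝ) = d := by simp
  rw [hdim]
  -- on `(0, R)` the integrand is `y^{d-3}`
  have heq : Set.EqOn (fun y : ℝ => y ^ ((d : ℝ) - 3)) (fun y : ℝ => y ^ (d - 1) • y ^ (-2 : ℝ)) (Set.Ioo 0 R) := by
    intro y hy
    have hy0 : 0 < y := hy.1
    simp only [smul_eq_mul]
    rw [← Real.rpow_natCast, ← Real.rpow_add hy0, Nat.cast_sub (by omega : 1 ≤ d)]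
    norm_num; ring_nf
  refine IntegrableOn.congr_fun ?_ heq measurableSet_Ioo
  have h3 : (3 : ℝ) ≤ d := by exact_mod_cast hd
  have hcont : Continuous fun y : ℝ => y ^ ((d : ℝ) - 3) := Real.continuous_rpow_const (by linarith)
  exact (hcont.continuousOn.integrableOn_Icc (a := 0) (b := R)).mono_set Set.Ioo_subset_Icc_self

/-- **`(1 - Ĵ)⁻¹` is integrable on `[-π,π]^d`** for `d ≥ 3`, for an absolutely summable even kernel
with the infrared bound `1 - Re Ĵ(k) ≥ K₀|k|²/(2d)` (`K₀ > 0`): `|1/(1 - Ĵ(k))| ≤ 2d/(K₀ ‖k‖_∞²)`.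
This is "the integrability of `{1 - Ĵ(k)}⁻¹` by (1.18)" (the well-definedness of `C(x)` in
Thm. 1.3). [cite: Hara2008, §2.1 (first sentence after (2.1)) and Thm. 1.3] -/
theorem integrableOn_inv_one_sub_latticeFT (hd : 3 ≤ d) {J : Site d → ℝ}
    (hJ : Summable fun x => |J x|) (hJe : ∀ x, J (-x) = J x) {K₀ : ℝ} (hK₀ : 0 < K₀)
    (hlow : ∀ k ∈ cube d, K₀ * (∑ i, k i ^ 2) / (2 * d) ≤ 1 - (latticeFT J k).re) :
    IntegrableOn (fun k => (1 - latticeFT J k)⁻¹) (cube d) := by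
  have hd0 : (0 : ℝ) < d := by exact_mod_cast (show 0 < d by omega)
  -- the dominating function
  set G : (Fin d → ℝ) → ℝ := fun k => 2 * d / K₀ * ‖k‖ ^ (-2 : ℝ) with hG
  have hGi : IntegrableOn G (cube d) :=
    ((integrableOn_norm_rpow_neg_two_ball hd (Real.pi + 1)).mono_set (cube_subset_ball d)).const_mul _
  have hmeas : AEStronglyMeasurable (fun k => (1 - latticeFT J k)⁻¹) (volume.restrict (cube d)) :=
    ((continuous_const.sub (continuous_latticeFT hJ)).measurable.inv).aestronglyMeasurable
  refine Integrable.mono' hGi hmeas ?_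
  have hcube : MeasurableSet (cube d) := measurableSet_cube d
  haveI : Nonempty (Fin d) := ⟨⟨0, by omega⟩⟩
  have h_ne : ∀ᵐ k ∂(volume.restrict (cube d)), k ≠ (0 : Fin d → ℝ) := by
    have h0 : (volume.restrict (cube d)) {(0 : Fin d → ℝ)} = 0 := by
      rw [Measure.restrict_apply (measurableSet_singleton 0)]
      exact measure_mono_null Set.inter_subset_left (measure_singleton 0)
    have := measure_eq_zero_iff_ae_notMem.1 h0
    filter_upwards [this] with k hk
    simpa using hk
  filter_upwards [ae_restrict_mem hcube, h_ne] with k hk hk0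
  have hre := hlow k hk
  have hpos : 0 < ∑ i, k i ^ 2 := by
    obtain ⟨i, hi⟩ : ∃ i, k i ≠ 0 := by
      by_contra h
      push Not at h
      exact hk0 (funext h)
    exact lt_of_lt_of_le (by positivity) (Finset.single_le_sum (fun j _ => sq_nonneg (k j)) (Finset.mem_univ i))
  have hre_pos : 0 < 1 - (latticeFT J k).re := lt_of_lt_of_le (by positivity) hre
  rw [one_sub_latticeFT_eq_ofReal hJ hJe, ← Complex.ofReal_inv, Complex.norm_real, Real.norm_eq_abs,
    abs_of_pos (inv_pos.2 hre_pos)]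
  have hnorm : ‖k‖ ^ 2 ≤ ∑ i, k i ^ 2 := norm_sq_le_sum_sq k
  have hnk : 0 < ‖k‖ := norm_pos_iff.2 hk0
  calc (1 - (latticeFT J k).re)⁻¹ ≤ (K₀ * (∑ i, k i ^ 2) / (2 * d))⁻¹ := inv_anti₀ (by positivity) hre
    _ = 2 * d / K₀ * (∑ i, k i ^ 2)⁻¹ := by field_simp
    _ ≤ 2 * d / K₀ * (‖k‖ ^ 2)⁻¹ := by gcongr
    _ = G k := by
        simp only [hG]
        rw [Real.rpow_neg (norm_nonneg k), show (2 : ℝ) = ((2 : ℕ) : ℝ) by norm_num, Real.rpow_natCast]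

end Literature.Barriers.CriticalPhenomena
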